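import Literature.AlgebraicGeometry.Motives.FrobeniusSemisimpleOfSelfProductTate
import Literature.AlgebraicGeometry.Motives.FrobeniusDominatedVarieties
import Literature.LinearAlgebra.SemisimpleOperatorInvariantSums
import Literature.LinearAlgebra.UnipotentLogarithmTensorProduct
import HarnessLib

/-!
# Semisimplicity of the Galois ∕ Frobenius action is stable under products, factors, Tate twists
# and dominations (Kahn 2020 §6.14 `SS^i`, Th. 6.54 ⟸; Milne 2007 Th. 1.3 «Künneth formula»)

Topic `Literature/AlgebraicGeometry/Motives`; THEOREMS ONLY (no definition, no instance, no named
fact; D-0026).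

B. Kahn, *Zeta and L-functions of varieties and motives* (2020) §6.14 (held, p. 132):
«`SS^i(X, l)` The action of `G` on `H^i_l(X)` is semisimple.» … «**Theorem 6.54** ([59, th. 6]) We
have the equivalence `S^d(X × X, l) ⟺ SS^i(X, l)` for all `i`.»  J. S. Milne, *The Tate conjecture
over finite fields (AIM talk)*, arXiv:0709.3040 (held, p. 3–4): «Weil proved that, for an abelian
variety `A` over `𝔽`, the Frobenius maps act semisimply on `H^1(A, ℚ_ℓ)`. It follows that they act
semisimply on all the cohomology groups `H^i(A, ℚ_ℓ) ≃ ⋀^i H^1(A, ℚ_ℓ)`»; Th. 1.3: «If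
`S^{2d}(X × X, ℓ)` is true, then every Frobenius map `π` acts semisimply on `H^*(X, ℚ_ℓ)`», proof:
«`H^r(X)_a ⊗ H^{2d-r}(X)(d)_{1/a} ⊂ H^{2d}(X × X)(d)_1` (Künneth formula)».

For the tree's abstract Galois Weil cohomology `E : GaloisWeilCohomology k K χ` (any field `k`,
coefficient field `K` of characteristic `0`) semisimplicity of the action of ONE element `g ∈ Γ_k`
on `Hⁱ(X)` is Mathlib's `Module.End.IsSemisimple (E.ρ X i g)` — for `k` finite and `g` the geometric Frobenius,
`Module.End.IsSemisimple (E.frobAction X i)`, Milne's «`π` acts semisimply on `Hⁱ(X, ℚ_ℓ)`». (The tree's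
`E.TateSemisimplicityFor X i` is the REPRESENTATION-level statement «every `Γ_k`-stable subspace has
a `Γ_k`-stable complement»; for `ℓ`-adic cohomology over a finite field the two agree because `Γ_k`
is topologically generated by Frobenius and the action is continuous — a link the axioms of `E` do
not contain, so it is not asserted here.)  This file proves:

* §1 KÜNNETH PIECES: the external products `extTensor : Hᵃ(X) ⊗ Hᵇ(Y) → Hᵃ⁺ᵇ(X × Y)` are
  injective (`extTensor_injective`), their images span (`iSup_range_extTensor_eq_top`), and they
  intertwine `ρ(g) ⊗ ρ(g)` with `ρ(g)` (`ρ_comp_extTensor`; from the tree's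
  `ρTwist_externalCup_right`).
* §2 **PRODUCTS**: if `g` acts semisimply on every `Hᵃ(X)` and `Hᵇ(Y)` with `a + b = d`, then it
  acts semisimply on `Hᵈ(X × Y)` (`isSemisimple_ρ_tensor`: each Künneth piece carries the
  semisimple `ρ_X(g) ⊗ ρ_Y(g)` — `Literature.LinearAlgebra.isSemisimple_tensorProductMap`, perfect
  coefficient field — and a sum of invariant pieces with semisimple restrictions is semisimple,
  `Literature.LinearAlgebra.isSemisimple_of_iSup_range_eq_top`); **FACTORS**: conversely
  semisimplicity on `Hⁱ(X × Y)` gives it on `Hⁱ(X)` and `Hⁱ(Y)` (`isSemisimple_ρ_of_tensor_left ∕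
  right`: `pr₁*`, `pr₂*` are injective intertwiners); hence
  `isSemisimple_ρ_tensor_iff` («`SS^•(X × Y) ⟺ SS^•(X) ∧ SS^•(Y)`») and the self-product
  `isSemisimple_ρ_tensor_self_iff` — the ⟸ half of Kahn's Th. 6.54 is `SS^•(X) ⟹ SS^•(X × X)`
  followed by «`SS^{2d} ⟹ S^d`» (row g38-#3).
* §3 TATE TWISTS: `Module.End.IsSemisimple (E.ρTwist X i j g) ⟺ Module.End.IsSemisimple (E.ρ X i g)`
  (`isSemisimple_ρTwist_iff`; a non-zero scalar multiple).
* §4 DOMINATIONS: semisimplicity descends along any morphism `f : V ⟶ U` with `f*` injective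
  (`isSemisimple_ρ_of_pullback_injective`), in particular along dominations `f₊ζ ≠ 0`
  (`isSemisimple_ρ_of_pushforward_ne_zero`, gen-36 API) and generically finite `f` of equal
  dimension (`_of_pullback_top_ne_zero`).
* §5 FROBENIUS (`k` finite): the same statements for `E.frobAction`
  (`isSemisimple_frobAction_tensor`, `_of_tensor_left ∕ right`, `_tensor_iff`, `_tensor_self_iff`,
  `_of_pushforward_ne_zero`).

## Provenance

Lane `lit-hodgefound` (summit `HodgeConjecture`, Track 2 foundations library, Layer B: motives),
seat `lit-hodgefound-p29` (literature-prover, generation 38, row g38-#2).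
-/

universe u v

open CategoryTheory AlgebraicGeometry MonoidalCategory CartesianMonoidalCategory
open scoped TensorProduct

noncomputable section

namespace Literature.AlgebraicGeometry.Motives

open Literature.LinearAlgebra

/-! ## §1 Künneth pieces -/

namespace WeilCohomology

variable {k : Type u} [Field k] {K : Type v} [Field K] [CharZero K] (W : WeilCohomology k K)
variable {n m : ℕ} {X Y : SchemeOver k}

/-- **A Künneth summand embeds**: `extTensor : Hᵃ(X) ⊗ Hᵇ(Y) → Hᵃ⁺ᵇ(X × Y)` is injective for `X`,
`Y` smooth projective (its Künneth component is a left inverse; axiom (B)).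
[cite: Kleiman1968AlgebraicCycles, §1.2 (B)] -/
theorem extTensor_injective (hX : IsSmoothProjective n X) (hY : IsSmoothProjective m Y)
    {a b d : ℕ} (h : a + b = d) : Function.Injective (W.extTensor (X := X) (Y := Y) h) :=
  Function.LeftInverse.injective (g := W.kunnethComponent hX hY a b h)
    (W.kunnethComponent_extTensor_self hX hY h)

/-- **The Künneth summands span**: `Hᵈ(X × Y) = Σ_{a+b=d} extTensor (Hᵃ(X) ⊗ Hᵇ(Y))` (every
class is the sum of the external products of its Künneth components).
[cite: Kleiman1968AlgebraicCycles, §1.2 (B)] -/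
theorem iSup_range_extTensor_eq_top (hX : IsSmoothProjective n X) (hY : IsSmoothProjective m Y)
    (d : ℕ) :
    ⨆ ij : ↥(Finset.antidiagonal d),
        LinearMap.range (W.extTensor (X := X) (Y := Y) (Finset.mem_antidiagonal.mp ij.2)) = ⊤ := by
  refine eq_top_iff.mpr fun u _ ↦ ?_
  rw [← W.sum_extTensor_kunnethComponent hX hY u]
  exact Submodule.sum_mem _ fun ij _ ↦
    Submodule.mem_iSup_of_mem ij (LinearMap.mem_range_self _ _)

end WeilCohomology

namespace GaloisWeilCohomology

variable {k : Type u} [Field k] {K : Type v} [Field K] [CharZero K]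
  {χ : Field.absoluteGaloisGroup k →* Kˣ} (E : GaloisWeilCohomology k K χ)
variable {n m : ℕ} {X Y : SchemeOver k}

/-- **The Künneth summand intertwines `ρ_X(g) ⊗ ρ_Y(g)` with `ρ_{X×Y}(g)`**:
`g ∘ extTensor = extTensor ∘ (g ⊗ g)` (the external product is Galois equivariant).
[cite: Tate1994, §1] [cite: Milne2007TateFiniteFieldsAIM, Th. 1.3 (proof: «Künneth formula»)] -/
theorem ρ_comp_extTensor (hX : IsSmoothProjective n X) (hY : IsSmoothProjective m Y)
    {a b d : ℕ} (h : a + b = d) (g : Field.absoluteGaloisGroup k) :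
    E.ρ (X ⊗ Y) d g ∘ₗ E.extTensor (X := X) (Y := Y) h =
      E.extTensor (X := X) (Y := Y) h ∘ₗ TensorProduct.map (E.ρ X a g) (E.ρ Y b g) := by
  refine TensorProduct.ext' fun x y ↦ ?_
  simp only [LinearMap.comp_apply, TensorProduct.map_tmul, WeilCohomology.extTensor_tmul]
  simpa only [ρTwist_zero] using E.ρTwist_externalCup_right hX hY h 0 g x y

/-! ## §2 Products and factors -/

/-- **`SS(X) ∧ SS(Y) ⟹ SS(X × Y)`, degreewise**: if `g ∈ Γ_k` acts semisimply on `Hᵃ(X)` and on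
`Hᵇ(Y)` whenever `a + b = d`, then it acts semisimply on `Hᵈ(X × Y)`. Proof: `Hᵈ(X × Y)` is the
sum of the `g`-stable Künneth pieces `extTensor(Hᵃ(X) ⊗ Hᵇ(Y))`, on which `g` acts through the
semisimple `ρ_X(g) ⊗ ρ_Y(g)` (tensor product of semisimple endomorphisms over the perfect field
`K`). This is the mechanism of the ⟸ half of Kahn's Th. 6.54 and of Milne's «Künneth formula».
[cite: Kahn2020, §6.14 Th. 6.54] [cite: Milne2007TateFiniteFieldsAIM, Th. 1.3 (proof)] -/
theorem isSemisimple_ρ_tensor (hX : IsSmoothProjective n X) (hY : IsSmoothProjective m Y)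
    (g : Field.absoluteGaloisGroup k) {d : ℕ}
    (h : ∀ a b : ℕ, a + b = d → Module.End.IsSemisimple (E.ρ X a g) ∧ Module.End.IsSemisimple (E.ρ Y b g)) :
    Module.End.IsSemisimple (E.ρ (X ⊗ Y) d g) := by
  refine isSemisimple_of_iSup_range_eq_top (E.ρ (X ⊗ Y) d g)
    (N := fun ij : ↥(Finset.antidiagonal d) ↦ E.obj X ij.1.1 ⊗[K] E.obj Y ij.1.2)
    (fun ij ↦ E.extTensor (X := X) (Y := Y) (Finset.mem_antidiagonal.mp ij.2))
    (fun ij ↦ TensorProduct.map (E.ρ X ij.1.1 g) (E.ρ Y ij.1.2 g))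
    (fun ij ↦ E.extTensor_injective hX hY _) (fun ij ↦ E.ρ_comp_extTensor hX hY _ g)
    (fun ij ↦ ?_) (E.iSup_range_extTensor_eq_top hX hY d)
  haveI := E.finite_obj hX ij.1.1
  haveI := E.finite_obj hY ij.1.2
  obtain ⟨h₁, h₂⟩ := h ij.1.1 ij.1.2 (Finset.mem_antidiagonal.mp ij.2)
  exact isSemisimple_tensorProductMap h₁ h₂

/-- **`SS^•(X) ∧ SS^•(Y) ⟹ SS^•(X × Y)`**: if `g` acts semisimply on all of `H^*(X)` and `H^*(Y)`
then on all of `H^*(X × Y)`. [cite: Kahn2020, §6.14 Th. 6.54] [cite: Milne2007TateFiniteFieldsAIM, Th. 1.3 (proof)] -/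
theorem isSemisimple_ρ_tensor_of_forall (hX : IsSmoothProjective n X) (hY : IsSmoothProjective m Y)
    (g : Field.absoluteGaloisGroup k) (hXs : ∀ a, Module.End.IsSemisimple (E.ρ X a g))
    (hYs : ∀ b, Module.End.IsSemisimple (E.ρ Y b g)) (d : ℕ) : Module.End.IsSemisimple (E.ρ (X ⊗ Y) d g) :=
  E.isSemisimple_ρ_tensor hX hY g fun a b _ ↦ ⟨hXs a, hYs b⟩

/-- **`SS^i(X × Y) ⟹ SS^i(X)`**: `pr₁* : Hⁱ(X) → Hⁱ(X × Y)` is an injective intertwiner (a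
`Γ_k`-stable copy of `Hⁱ(X)` inside `Hⁱ(X × Y)`). [cite: Kahn2020, §6.14 SS^i(X, l)] [cite: Tate1994, §1] -/
theorem isSemisimple_ρ_of_tensor_left (hX : IsSmoothProjective n X) (hY : IsSmoothProjective m Y)
    (g : Field.absoluteGaloisGroup k) {i : ℕ} (h : Module.End.IsSemisimple (E.ρ (X ⊗ Y) i g)) :
    Module.End.IsSemisimple (E.ρ X i g) :=
  isSemisimple_of_comp_eq_of_injective h (E.pullback_fst_injective hX hY i)
    (E.pullback_ρ (IsSmoothProjective.tensor_holds hX hY) hX (fst X Y) i g)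

/-- **`SS^i(X × Y) ⟹ SS^i(Y)`** (via `pr₂*`). [cite: Kahn2020, §6.14 SS^i(X, l)] [cite: Tate1994, §1] -/
theorem isSemisimple_ρ_of_tensor_right (hX : IsSmoothProjective n X) (hY : IsSmoothProjective m Y)
    (g : Field.absoluteGaloisGroup k) {i : ℕ} (h : Module.End.IsSemisimple (E.ρ (X ⊗ Y) i g)) :
    Module.End.IsSemisimple (E.ρ Y i g) :=
  isSemisimple_of_comp_eq_of_injective h (E.pullback_snd_injective hX hY i)
    (E.pullback_ρ (IsSmoothProjective.tensor_holds hX hY) hY (snd X Y) i g)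

/-- **`SS^•(X × Y) ⟺ SS^•(X) ∧ SS^•(Y)`** for the action of any `g ∈ Γ_k`.
[cite: Kahn2020, §6.14 Th. 6.54] [cite: Milne2007TateFiniteFieldsAIM, Th. 1.3 (proof)] -/
theorem isSemisimple_ρ_tensor_iff (hX : IsSmoothProjective n X) (hY : IsSmoothProjective m Y)
    (g : Field.absoluteGaloisGroup k) :
    (∀ d, Module.End.IsSemisimple (E.ρ (X ⊗ Y) d g)) ↔
      (∀ a, Module.End.IsSemisimple (E.ρ X a g)) ∧ ∀ b, Module.End.IsSemisimple (E.ρ Y b g) :=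
  ⟨fun h ↦ ⟨fun a ↦ E.isSemisimple_ρ_of_tensor_left hX hY g (h a),
    fun b ↦ E.isSemisimple_ρ_of_tensor_right hX hY g (h b)⟩,
    fun h ↦ E.isSemisimple_ρ_tensor_of_forall hX hY g h.1 h.2⟩

/-- **`SS^•(X × X) ⟺ SS^•(X)`** (self-product; the first step of Kahn Th. 6.54 ⟸).
[cite: Kahn2020, §6.14 Th. 6.54] -/
theorem isSemisimple_ρ_tensor_self_iff (hX : IsSmoothProjective n X)
    (g : Field.absoluteGaloisGroup k) :
    (∀ d, Module.End.IsSemisimple (E.ρ (X ⊗ X) d g)) ↔ ∀ a, Module.End.IsSemisimple (E.ρ X a g) := by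
  rw [E.isSemisimple_ρ_tensor_iff hX hX g, and_self_iff]

/-- In a given degree `d`, `SS^d(X × Y)` needs only the degrees `a, b ≤ d` of the factors.
[cite: Kahn2020, §6.14 Th. 6.54] -/
theorem isSemisimple_ρ_tensor_of_forall_le (hX : IsSmoothProjective n X)
    (hY : IsSmoothProjective m Y) (g : Field.absoluteGaloisGroup k) {d : ℕ}
    (hXs : ∀ a ≤ d, Module.End.IsSemisimple (E.ρ X a g)) (hYs : ∀ b ≤ d, Module.End.IsSemisimple (E.ρ Y b g)) :
    Module.End.IsSemisimple (E.ρ (X ⊗ Y) d g) :=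
  E.isSemisimple_ρ_tensor hX hY g fun a b hab ↦ ⟨hXs a (by omega), hYs b (by omega)⟩

/-! ## §3 Tate twists -/

/-- Semisimplicity is insensitive to Tate twists: `χ(g)ʲ ρ(g)` is semisimple iff `ρ(g)` is
(a non-zero scalar multiple). [cite: Tate1994, §1] [cite: Kahn2020, §6.14 SS^i(X, l)] -/
theorem isSemisimple_ρTwist_iff (X : SchemeOver k) (i : ℕ) (j : ℤ)
    (g : Field.absoluteGaloisGroup k) :
    Module.End.IsSemisimple (E.ρTwist X i j g) ↔ Module.End.IsSemisimple (E.ρ X i g) := by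
  have h : E.ρTwist X i j g = ((χ g : K) ^ j) • E.ρ X i g := LinearMap.ext fun x ↦ rfl
  rw [h]
  exact Module.End.IsSemisimple_smul_iff (zpow_ne_zero j (χ g).ne_zero)

/-! ## §4 Dominations -/

variable {N M : ℕ} {V U : SchemeOver k}

/-- **Semisimplicity descends along injective pull-backs**: if `f : V ⟶ U` has `f* : Hⁱ(U) → Hⁱ(V)`
injective and `g` acts semisimply on `Hⁱ(V)`, then it acts semisimply on `Hⁱ(U)` (`f*` is an
injective intertwiner). [cite: Kahn2020, §6.14 SS^i(X, l)] [cite: Tate1994, §1] -/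
theorem isSemisimple_ρ_of_pullback_injective (hV : IsSmoothProjective N V)
    (hU : IsSmoothProjective M U) (f : V ⟶ U) {i : ℕ} (hf : Function.Injective (E.pullback f i))
    (g : Field.absoluteGaloisGroup k) (h : Module.End.IsSemisimple (E.ρ V i g)) : Module.End.IsSemisimple (E.ρ U i g) :=
  isSemisimple_of_comp_eq_of_injective h hf (E.pullback_ρ hV hU f i g)

/-- **Semisimplicity descends along dominations**: if `f : V ⟶ U` and a rational algebraic class
`ζ ∈ Aʳ(V)_ℚ` have `f₊ζ ≠ 0` (e.g. `f` dominant and generically finite onto its image composed with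
a section), then `SS^i(V) ⟹ SS^i(U)` for every `g` (the tree's
`pullback_injective_of_pushforward_ne_zero`, Kleiman Prop. 1.2.4).
[cite: Kahn2020, §6.14 SS^i(X, l)] [cite: Kleiman1968AlgebraicCycles, Prop. 1.2.4] -/
theorem isSemisimple_ρ_of_pushforward_ne_zero (hV : IsSmoothProjective N V)
    (hU : IsSmoothProjective M U) (f : V ⟶ U) {r : ℕ} {ζ : E.obj V (2 * r)}
    (hζ : ζ ∈ E.ratAlgebraicClasses V r) {he : 2 * r + 2 * M = 2 * N} {hd : 0 + 2 * M = 2 * M}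
    (hne : E.pushforward (N := N) hU f he hd ζ ≠ 0) (g : Field.absoluteGaloisGroup k) {i : ℕ}
    (h : Module.End.IsSemisimple (E.ρ V i g)) : Module.End.IsSemisimple (E.ρ U i g) :=
  E.isSemisimple_ρ_of_pullback_injective hV hU f
    (E.pullback_injective_of_pushforward_ne_zero hV hU f hζ hne i) g h

/-- Equidimensional form: `f : V ⟶ U` between smooth projective varieties of the same dimension
with `f* ≠ 0` in top degree (generically finite, `deg f ≠ 0`): `SS^i(V) ⟹ SS^i(U)`.
[cite: Kahn2020, §6.14 SS^i(X, l)] [cite: Kleiman1968AlgebraicCycles, Prop. 1.2.4] -/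
theorem isSemisimple_ρ_of_pullback_top_ne_zero (hV : IsSmoothProjective N V)
    (hU : IsSmoothProjective N U) (f : V ⟶ U) (hf : E.pullback f (2 * N) ≠ 0)
    (g : Field.absoluteGaloisGroup k) {i : ℕ} (h : Module.End.IsSemisimple (E.ρ V i g)) :
    Module.End.IsSemisimple (E.ρ U i g) :=
  E.isSemisimple_ρ_of_pullback_injective hV hU f
    (E.pullback_injective_of_pullback_top_ne_zero hV hU f hf i) g h

/-! ## §5 The Frobenius endomorphism over a finite field -/

section Frobenius

variable [Finite k]

/-- **`SS(X) ∧ SS(Y) ⟹ SS(X × Y)` for Frobenius, degreewise**: if `F` acts semisimply on `Hᵃ(X)`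
and `Hᵇ(Y)` for `a + b = d` then on `Hᵈ(X × Y)`. [cite: Kahn2020, §6.14 Th. 6.54]
[cite: Milne2007TateFiniteFieldsAIM, Th. 1.3 (proof: «Künneth formula»)] -/
theorem isSemisimple_frobAction_tensor (hX : IsSmoothProjective n X) (hY : IsSmoothProjective m Y)
    {d : ℕ} (h : ∀ a b : ℕ, a + b = d →
      Module.End.IsSemisimple (E.frobAction X a) ∧ Module.End.IsSemisimple (E.frobAction Y b)) :
    Module.End.IsSemisimple (E.frobAction (X ⊗ Y) d) :=
  E.isSemisimple_ρ_tensor hX hY (geomFrob k) h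

/-- **`SS^•(X) ∧ SS^•(Y) ⟹ SS^•(X × Y)` for Frobenius.** [cite: Kahn2020, §6.14 Th. 6.54]
[cite: Milne2007TateFiniteFieldsAIM, Th. 1.3 (proof)] -/
theorem isSemisimple_frobAction_tensor_of_forall (hX : IsSmoothProjective n X)
    (hY : IsSmoothProjective m Y) (hXs : ∀ a, Module.End.IsSemisimple (E.frobAction X a))
    (hYs : ∀ b, Module.End.IsSemisimple (E.frobAction Y b)) (d : ℕ) :
    Module.End.IsSemisimple (E.frobAction (X ⊗ Y) d) :=
  E.isSemisimple_ρ_tensor_of_forall hX hY (geomFrob k) hXs hYs d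

/-- **`SS^i(X × Y) ⟹ SS^i(X)` for Frobenius.** [cite: Kahn2020, §6.14 SS^i(X, l)] -/
theorem isSemisimple_frobAction_of_tensor_left (hX : IsSmoothProjective n X)
    (hY : IsSmoothProjective m Y) {i : ℕ} (h : Module.End.IsSemisimple (E.frobAction (X ⊗ Y) i)) :
    Module.End.IsSemisimple (E.frobAction X i) :=
  E.isSemisimple_ρ_of_tensor_left hX hY (geomFrob k) h

/-- **`SS^i(X × Y) ⟹ SS^i(Y)` for Frobenius.** [cite: Kahn2020, §6.14 SS^i(X, l)] -/
theorem isSemisimple_frobAction_of_tensor_right (hX : IsSmoothProjective n X)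
    (hY : IsSmoothProjective m Y) {i : ℕ} (h : Module.End.IsSemisimple (E.frobAction (X ⊗ Y) i)) :
    Module.End.IsSemisimple (E.frobAction Y i) :=
  E.isSemisimple_ρ_of_tensor_right hX hY (geomFrob k) h

/-- **`SS^•(X × Y) ⟺ SS^•(X) ∧ SS^•(Y)` for Frobenius** («every Frobenius map acts semisimply on
`H^*`» is stable under products and factors). [cite: Kahn2020, §6.14 Th. 6.54]
[cite: Milne2007TateFiniteFieldsAIM, Th. 1.3] -/
theorem isSemisimple_frobAction_tensor_iff (hX : IsSmoothProjective n X)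
    (hY : IsSmoothProjective m Y) :
    (∀ d, Module.End.IsSemisimple (E.frobAction (X ⊗ Y) d)) ↔
      (∀ a, Module.End.IsSemisimple (E.frobAction X a)) ∧ ∀ b, Module.End.IsSemisimple (E.frobAction Y b) :=
  E.isSemisimple_ρ_tensor_iff hX hY (geomFrob k)

/-- **`SS^•(X × X) ⟺ SS^•(X)` for Frobenius** (Kahn Th. 6.54 ⟸, first step).
[cite: Kahn2020, §6.14 Th. 6.54] -/
theorem isSemisimple_frobAction_tensor_self_iff (hX : IsSmoothProjective n X) :
    (∀ d, Module.End.IsSemisimple (E.frobAction (X ⊗ X) d)) ↔ ∀ a, Module.End.IsSemisimple (E.frobAction X a) :=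
  E.isSemisimple_ρ_tensor_self_iff hX (geomFrob k)

/-- The twisted Frobenius `χ(F)ʲ F` on `Hⁱ(X)` is semisimple iff `F` is.
[cite: Milne2007TateFiniteFieldsAIM, §1 Conjecture S^r(X, ℓ)] -/
theorem isSemisimple_ρTwist_geomFrob_iff (X : SchemeOver k) (i : ℕ) (j : ℤ) :
    Module.End.IsSemisimple (E.ρTwist X i j (geomFrob k)) ↔ Module.End.IsSemisimple (E.frobAction X i) :=
  E.isSemisimple_ρTwist_iff X i j (geomFrob k)

/-- **Frobenius semisimplicity descends along dominations** `f : V ⟶ U`, `f₊ζ ≠ 0`.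
[cite: Kahn2020, §6.14 SS^i(X, l)] [cite: Kleiman1968AlgebraicCycles, Prop. 1.2.4] -/
theorem isSemisimple_frobAction_of_pushforward_ne_zero (hV : IsSmoothProjective N V)
    (hU : IsSmoothProjective M U) (f : V ⟶ U) {r : ℕ} {ζ : E.obj V (2 * r)}
    (hζ : ζ ∈ E.ratAlgebraicClasses V r) {he : 2 * r + 2 * M = 2 * N} {hd : 0 + 2 * M = 2 * M}
    (hne : E.pushforward (N := N) hU f he hd ζ ≠ 0) {i : ℕ}
    (h : Module.End.IsSemisimple (E.frobAction V i)) : Module.End.IsSemisimple (E.frobAction U i) :=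
  E.isSemisimple_ρ_of_pushforward_ne_zero hV hU f hζ hne (geomFrob k) h

/-- Frobenius semisimplicity descends along `f : V ⟶ U` with `f*` injective in degree `i`.
[cite: Kahn2020, §6.14 SS^i(X, l)] -/
theorem isSemisimple_frobAction_of_pullback_injective (hV : IsSmoothProjective N V)
    (hU : IsSmoothProjective M U) (f : V ⟶ U) {i : ℕ} (hf : Function.Injective (E.pullback f i))
    (h : Module.End.IsSemisimple (E.frobAction V i)) : Module.End.IsSemisimple (E.frobAction U i) :=
  E.isSemisimple_ρ_of_pullback_injective hV hU f hf (geomFrob k) h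

end Frobenius

end GaloisWeilCohomology

end Literature.AlgebraicGeometry.Motives

end
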